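import Summits.BirchSwinnertonDyer.BirchSwinnertonDyer.Theorems.ManinLocalTwoThreeStevensCuspTransport
import Summits.BirchSwinnertonDyer.BirchSwinnertonDyer.Theorems.ManinLocalTwoThreeComplexAutFixedField
import Literature.NumberTheory.EllipticCurves.Gamma1ParametrizationCuspRationality
import Literature.NumberTheory.EllipticCurves.ModularCurveGamma0IndexProofs
import HarnessLib

/-!
# The cusps over `∞` of an `X₁(N)`-parametrisation have RATIONAL values (`optimalGamma1Parametrization_cusp_rational` holds)
(route `ManinLocalTwoThree`, crux C2 `ManinOddAtFour` stmt-BirchSwinnertonDyer-22967; cell bsd-f2-manin, LEAD prover p1 gen 22;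
`--supports stmt-BirchSwinnertonDyer-22967`)

THEOREM (`optimalGamma1Parametrization_cusp_rational_holds`, the named fact of `Literature…Gamma1ParametrizationCuspRationality`,
Conrad–Edixhoven–Stein 2003 §6.1.2 / §6.2; its hypothesis `D.IsOptimal` is not used).  For every elliptic `W/ℚ`, every `X₁(N)`-datum `D`
and every `γ ∈ Γ₀(N)`, the value `u(c·{∞, γ∞}_f)` is the base change of a point of `W(ℚ)`.

PROOF.  Let `σ ∈ Aut_ℚ(ℂ)`; `σ(ζ_N) = ζ_N^d` for some `d` prime to `N` (`ζ_N = e^{2πi/N}` is a primitive root), `dd′ ≡ 1 (N)`.  Lift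
`(γ₀₀, dγ₀₁; d′γ₁₀, γ₁₁) ∈ SL₂(ℤ/N)` to `γ′ ∈ SL₂(ℤ)` off `∞` (`specialLinearGroup_map_surjective`).  By Stevens (b) for general cusps
(`StevensGalois.map_uniformize_cusp_general`) `σ(u(c{∞,γ∞})) = u(c{∞,γ′∞})`.  Since `γ ∈ Γ₀(N)`, `γ′₁₀ ≡ d′γ₁₀ ≡ 0`, so `γ′ ∈ Γ₀(N)` and
`η = γ′γ⁻¹ ≡ (1,*;0,1)`, i.e. `η ∈ Γ₁(N)`; Manin's cocycle `{∞,γ′∞} = {∞,η∞} + {∞,γ∞}` with `c{∞,η∞} ∈ cΛ₁(f) ⊆ Λ_W` gives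
`u(c{∞,γ′∞}) = u(c{∞,γ∞})`.  So the value is fixed by all of `Aut_ℚ(ℂ)`, and its coordinates are rational by the fixed-field theorem
(`ComplexAut.mem_of_forall_algEquiv ⊥`).

HONEST FRAMING.  Discharges a named Literature fact (statement-only so far).  Nothing about C2, Manin's conjecture or BSD is proved here.
[cite: ConradEdixhovenStein2003, §6.1.2 proof of Lemma 6.1.6 (p. 381) and §6.2 (p. 386)] [cite: Stevens1982, §1.3 Thm. 1.3.1]
[cite: ShimuraIATAF1971, Lemma 1.38]
-/

-- lint-debt: the directory name repeats the summit name (sibling precedent `ManinLocalTwoThreeStevensCuspInvGaloisAction.lean`)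
set_option linter.dupNamespace false
set_option autoImplicit false

noncomputable section

open Complex
open scoped Real MatrixGroups PeriodPair
open CongruenceSubgroup
open Literature.NumberTheory.EllipticCurves Literature.NumberTheory.EllipticCurves.ModularForms

namespace Summit.BirchSwinnertonDyer.BirchSwinnertonDyer.Theorems.ManinLocalTwoThree.StevensGalois

variable {N : ℕ} [NeZero N]

/-! ## §1 Matrix bookkeeping -/

/-- A lift of an element of `SL₂(ℤ/N)` to `SL₂(ℤ)` with non-zero lower-left entry (multiply a lift by `(1,0;N,1) ∈ Γ(N)` if necessary).
[cite: ShimuraIATAF1971, Lemma 1.38] -/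
theorem exists_lift_lowerLeft_ne_zero (M : SL(2, ZMod N)) :
    ∃ γ : SL(2, ℤ), Matrix.SpecialLinearGroup.map (Int.castRingHom (ZMod N)) γ = M ∧ (γ 1 0 : ℤ) ≠ 0 := by
  obtain ⟨γ₁, hγ₁⟩ := specialLinearGroup_map_surjective N M
  by_cases h : (γ₁ 1 0 : ℤ) = 0
  · have hdet : (γ₁ 0 0 : ℤ) * γ₁ 1 1 - γ₁ 0 1 * γ₁ 1 0 = 1 := by
      rw [← Matrix.det_fin_two, γ₁.det_coe]
    have h00 : (γ₁ 0 0 : ℤ) ≠ 0 := by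
      intro h0; rw [h0, h] at hdet; simp at hdet
    set η : SL(2, ℤ) := ⟨!![1, 0; (N : ℤ), 1], by simp [Matrix.det_fin_two_of]⟩ with hη
    have hηΓ : η ∈ CongruenceSubgroup.Gamma N := by
      rw [CongruenceSubgroup.Gamma_mem]; simp [hη]
    refine ⟨η * γ₁, ?_, ?_⟩
    · rw [map_mul, hγ₁]
      have : Matrix.SpecialLinearGroup.map (Int.castRingHom (ZMod N)) η = 1 := by
        rwa [CongruenceSubgroup.Gamma_mem'] at hηΓ
      rw [this, one_mul]
    · have e : ((η * γ₁) 1 0 : ℤ) = (N : ℤ) * γ₁ 0 0 + γ₁ 1 0 := by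
        simp [hη, Matrix.mul_apply, Fin.sum_univ_two]
      rw [e, h, add_zero]
      exact mul_ne_zero (by exact_mod_cast NeZero.ne N) h00
  · exact ⟨γ₁, hγ₁, h⟩

omit [NeZero N] in
/-- Entries of `γ′γ⁻¹` in `SL₂(ℤ)`. [folklore] -/
private theorem mul_inv_entries (γ γ' : SL(2, ℤ)) :
    ((γ' * γ⁻¹) 0 0 : ℤ) = γ' 0 0 * γ 1 1 - γ' 0 1 * γ 1 0 ∧
    ((γ' * γ⁻¹) 1 0 : ℤ) = γ' 1 0 * γ 1 1 - γ' 1 1 * γ 1 0 ∧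
    ((γ' * γ⁻¹) 1 1 : ℤ) = - (γ' 1 0 * γ 0 1) + γ' 1 1 * γ 0 0 := by
  simp only [Matrix.SpecialLinearGroup.coe_mul, Matrix.SpecialLinearGroup.coe_inv, Matrix.adjugate_fin_two,
    Matrix.mul_apply, Fin.sum_univ_two, Matrix.of_apply, Matrix.cons_val', Matrix.cons_val_zero, Matrix.cons_val_one,
    Matrix.empty_val', Matrix.cons_val_fin_one]
  refine ⟨by ring, by ring, by ring⟩

/-! ## §2 Every `σ ∈ Aut_ℚ(ℂ)` fixes the values at the cusps over `∞` -/

/-- For `σ ∈ Aut_ℚ(ℂ)`: `σ(e^{2πi/N}) = e^{2πid/N}` for some `d` with an inverse `d′` modulo `N`. [folklore] -/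
theorem exists_exp_conj_pow (σ : ℂ ≃ₐ[ℚ] ℂ) :
    ∃ d d' : ℤ, ((d * d' : ℤ) : ZMod N) = 1 ∧ σ (cexp (2 * π * Complex.I / N)) = cexp (2 * π * Complex.I * d / N) := by
  have hζ : IsPrimitiveRoot (cexp (2 * π * Complex.I / N)) N := Complex.isPrimitiveRoot_exp N (NeZero.ne N)
  have hσN : (σ (cexp (2 * π * Complex.I / N))) ^ N = 1 := by rw [← map_pow, hζ.pow_eq_one, map_one]
  obtain ⟨i, -, hi⟩ := hζ.eq_pow_of_pow_eq_one hσN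
  have hprim : IsPrimitiveRoot (σ (cexp (2 * π * Complex.I / N))) N := hζ.map_of_injective σ.injective
  rw [← hi] at hprim
  have hcop : i.Coprime N := (hζ.pow_iff_coprime (NeZero.pos N) i).mp hprim
  obtain ⟨u, v, huv⟩ := Nat.isCoprime_iff_coprime.mpr hcop
  refine ⟨i, u, ?_, ?_⟩
  · have h := congrArg (fun z : ℤ ↦ (z : ZMod N)) huv
    simp only [Int.cast_add, Int.cast_mul, Int.cast_natCast, ZMod.natCast_self, mul_zero, add_zero, Int.cast_one] at h
    push_cast
    linear_combination h
  · rw [← hi, ← Complex.exp_nat_mul]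
    congr 1
    push_cast
    ring

/-- **Every `σ ∈ Aut_ℚ(ℂ)` fixes `u(c·{∞,γ∞}_f)` for `γ ∈ Γ₀(N)`** (the cusps over `∞` of `X₁(N)`): Stevens (b) for the pair `(γ, γ′)`,
`γ′` a lift of `diag(1,d′)γdiag(1,d)`, and `γ′γ⁻¹ ∈ Γ₁(N)`. [cite: Stevens1982, §1.3 Thm. 1.3.1] [cite: Manin1972, Prop. 1.4] -/
theorem map_uniformize_cuspSymbol_eq_self {W : WeierstrassCurve ℚ} [W.IsElliptic] (D₁ : Gamma1ParametrizationData W N)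
    (σ : ℂ ≃ₐ[ℚ] ℂ) (γ : Gamma0 N) :
    WeierstrassCurve.Affine.Point.map (W' := W) (σ : ℂ →ₐ[ℚ] ℂ) (D₁.uniformize ((D₁.c : ℂ) * cuspSymbol D₁.f γ)) =
      D₁.uniformize ((D₁.c : ℂ) * cuspSymbol D₁.f γ) := by
  classical
  by_cases hγ10 : ((γ : SL(2, ℤ)) 1 0 : ℤ) = 0
  · have h0 : cuspSymbol D₁.f γ = 0 := by simp [cuspSymbol, hγ10]
    rw [h0, mul_zero, map_zero, map_zero]
  have hc0 : D₁.c ≠ 0 := D₁.maninConstant_ne_zero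
  have hc : (D₁.c : ℂ) ≠ 0 := by exact_mod_cast hc0
  obtain ⟨d, d', hdd, hσ⟩ := exists_exp_conj_pow (N := N) σ
  -- the matrix `diag(1,d′) γ diag(1,d) mod N` and a lift `γ′` off `∞`
  have hdetγ : ((γ : SL(2, ℤ)) 0 0 : ℤ) * (γ : SL(2, ℤ)) 1 1 - (γ : SL(2, ℤ)) 0 1 * (γ : SL(2, ℤ)) 1 0 = 1 := by
    rw [← Matrix.det_fin_two, (γ : SL(2, ℤ)).det_coe]
  have hdetM : Matrix.det !![(((γ : SL(2, ℤ)) 0 0 : ℤ) : ZMod N), (d : ZMod N) * (((γ : SL(2, ℤ)) 0 1 : ℤ) : ZMod N);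
      (d' : ZMod N) * (((γ : SL(2, ℤ)) 1 0 : ℤ) : ZMod N), (((γ : SL(2, ℤ)) 1 1 : ℤ) : ZMod N)] = 1 := by
    have h1 := congrArg (fun z : ℤ ↦ (z : ZMod N)) hdetγ
    simp only [Int.cast_sub, Int.cast_mul, Int.cast_one] at h1
    have h2 : (d : ZMod N) * (d' : ZMod N) = 1 := by exact_mod_cast hdd
    rw [Matrix.det_fin_two_of]
    linear_combination h1 - ((((γ : SL(2, ℤ)) 0 1 : ℤ) : ZMod N) * (((γ : SL(2, ℤ)) 1 0 : ℤ) : ZMod N)) * h2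
  obtain ⟨γ', hγ'M, hγ'10⟩ := exists_lift_lowerLeft_ne_zero (N := N) ⟨_, hdetM⟩
  have hent : ∀ i j : Fin 2, ((γ' i j : ℤ) : ZMod N) =
      !![(((γ : SL(2, ℤ)) 0 0 : ℤ) : ZMod N), (d : ZMod N) * (((γ : SL(2, ℤ)) 0 1 : ℤ) : ZMod N);
        (d' : ZMod N) * (((γ : SL(2, ℤ)) 1 0 : ℤ) : ZMod N), (((γ : SL(2, ℤ)) 1 1 : ℤ) : ZMod N)] i j := by
    intro i j
    have h := congrArg (fun m : SL(2, ZMod N) ↦ (m : Matrix (Fin 2) (Fin 2) (ZMod N)) i j) hγ'M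
    simpa using h
  have h00 : ((γ' 0 0 : ℤ) : ZMod N) = (((γ : SL(2, ℤ)) 0 0 : ℤ) : ZMod N) := by simpa using hent 0 0
  have h01 : ((γ' 0 1 : ℤ) : ZMod N) = (d : ZMod N) * (((γ : SL(2, ℤ)) 0 1 : ℤ) : ZMod N) := by simpa using hent 0 1
  have h10 : ((γ' 1 0 : ℤ) : ZMod N) = (d' : ZMod N) * (((γ : SL(2, ℤ)) 1 0 : ℤ) : ZMod N) := by simpa using hent 1 0
  have h11 : ((γ' 1 1 : ℤ) : ZMod N) = (((γ : SL(2, ℤ)) 1 1 : ℤ) : ZMod N) := by simpa using hent 1 1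
  -- Stevens (b) for the pair `(γ, γ′)`
  have hT := map_uniformize_cusp_general D₁ σ hdd hσ (γ : SL(2, ℤ)) γ' hγ10 hγ'10 h00 h01 h10 h11
  have hcs : cuspSymbol D₁.f γ = modularSymbol D₁.f ((((γ : SL(2, ℤ)) 0 0 : ℤ) : ℚ) / (((γ : SL(2, ℤ)) 1 0 : ℤ) : ℚ)) := by
    simp [cuspSymbol, hγ10]
  rw [hcs, hT]
  -- `γ′ ∈ Γ₀(N)` and `η = γ′γ⁻¹ ∈ Γ₁(N)`
  have hγΓ0 : (((γ : SL(2, ℤ)) 1 0 : ℤ) : ZMod N) = 0 := Gamma0_mem.mp γ.2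
  have hγ'Γ0 : γ' ∈ Gamma0 N := by
    rw [Gamma0_mem]
    simp only [h10, hγΓ0, mul_zero]
  set γ'₀ : Gamma0 N := ⟨γ', hγ'Γ0⟩ with hγ'₀
  set η : Gamma0 N := γ'₀ * γ⁻¹ with hηdef
  have haδ : (((γ : SL(2, ℤ)) 0 0 : ℤ) : ZMod N) * (((γ : SL(2, ℤ)) 1 1 : ℤ) : ZMod N) = 1 := by
    have h1 := congrArg (fun z : ℤ ↦ (z : ZMod N)) hdetγ
    simp only [Int.cast_sub, Int.cast_mul, Int.cast_one, hγΓ0, mul_zero, sub_zero] at h1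
    exact h1
  have hηΓ1 : ((η : Gamma0 N) : SL(2, ℤ)) ∈ Gamma1 N := by
    have hcoe : ((η : Gamma0 N) : SL(2, ℤ)) = γ' * (γ : SL(2, ℤ))⁻¹ := by simp [hηdef, hγ'₀]
    obtain ⟨e00, e10, e11⟩ := mul_inv_entries (γ : SL(2, ℤ)) γ'
    rw [Gamma1_mem, hcoe, e00, e10, e11]
    push_cast
    rw [h00, h01, h10, h11, hγΓ0]
    refine ⟨?_, ?_, ?_⟩
    · linear_combination haδ
    · linear_combination haδ
    · ring
  -- Manin's cocycle: `{∞, γ′∞} = {∞, η∞} + {∞, γ∞}`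
  have hmul : η * γ = γ'₀ := by rw [hηdef, inv_mul_cancel_right]
  have hcoc : cuspSymbol D₁.f γ'₀ = cuspSymbol D₁.f η + cuspSymbol D₁.f γ := by
    rw [← hmul]; exact cuspSymbol_mul_holds D₁.f η γ
  have hcs' : cuspSymbol D₁.f γ'₀ = modularSymbol D₁.f (((γ' 0 0 : ℤ) : ℚ) / ((γ' 1 0 : ℤ) : ℚ)) := by
    simp [cuspSymbol, hγ'₀, hγ'10]
  have hηL : (D₁.c : ℂ) * cuspSymbol D₁.f η ∈ D₁.L.lattice := by
    have h := cuspSymbol_mem_L₁ D₁ hc η hηΓ1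
    rwa [PeriodPair.mem_mulLeft_lattice, inv_inv] at h
  have hker : D₁.uniformize ((D₁.c : ℂ) * cuspSymbol D₁.f η) = 0 := by
    rw [← AddMonoidHom.mem_ker, ← SetLike.mem_coe, D₁.ker_uniformize]
    exact hηL
  rw [← hcs', hcoc, mul_add, map_add, hker, zero_add, hcs]

/-! ## §3 The named fact -/

/-- **`optimalGamma1Parametrization_cusp_rational` HOLDS** (Conrad–Edixhoven–Stein 2003 §6.1.2 / §6.2 as typed; `D.IsOptimal` unused): the value of
an `X₁(N)`-parametrisation at every cusp over `∞` is a `ℚ`-rational point. [cite: ConradEdixhovenStein2003, §6.1.2 proof of Lemma 6.1.6 (p. 381)] -/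
theorem optimalGamma1Parametrization_cusp_rational_holds : optimalGamma1Parametrization_cusp_rational := by
  intro W _ N _ D₁ _ γ
  classical
  have hfix := map_uniformize_cuspSymbol_eq_self D₁ (N := N)
  rcases hPt : D₁.uniformize ((D₁.c : ℂ) * cuspSymbol D₁.f γ) with _ | ⟨xv, yv, hns⟩
  · exact ⟨0, rfl⟩
  · have hco : ∀ σ : ℂ ≃ₐ[ℚ] ℂ, σ xv = xv ∧ σ yv = yv := by
      intro σ
      have h := hfix σ γ
      have eσ : ∀ w : ℂ, (σ : ℂ →ₐ[ℚ] ℂ) w = σ w := fun _ ↦ rfl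
      rw [hPt, WeierstrassCurve.Affine.Point.map_some] at h
      simpa only [WeierstrassCurve.Affine.Point.some.injEq, eσ] using h
    have hx : xv ∈ (⊥ : IntermediateField ℚ ℂ) := ComplexAut.mem_of_forall_algEquiv ⊥ fun σ _ ↦ (hco σ).1
    have hy : yv ∈ (⊥ : IntermediateField ℚ ℂ) := ComplexAut.mem_of_forall_algEquiv ⊥ fun σ _ ↦ (hco σ).2
    rw [IntermediateField.mem_bot] at hx hy
    obtain ⟨qx, hqx⟩ := hx
    obtain ⟨qy, hqy⟩ := hy
    have hns' : (W.baseChange ℚ).toAffine.Nonsingular qx qy := by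
      refine (WeierstrassCurve.Affine.baseChange_nonsingular (W := W.toAffine) (f := Algebra.ofId ℚ ℂ)
        (algebraMap ℚ ℂ).injective qx qy).mp ?_
      rw [Algebra.ofId_apply, Algebra.ofId_apply, hqx, hqy]
      exact hns
    refine ⟨WeierstrassCurve.Affine.Point.some _ _ hns', ?_⟩
    rw [WeierstrassCurve.Affine.Point.map_some]
    simp only [WeierstrassCurve.Affine.Point.some.injEq]
    exact ⟨hqx, hqy⟩

end Summit.BirchSwinnertonDyer.BirchSwinnertonDyer.Theorems.ManinLocalTwoThree.StevensGalois

end
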